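import Summits.QuantumFields.BalabanUV.T4Continuum.Support.NE7FlatLiftBookkeeping
import Summits.QuantumFields.BalabanUV.T4Continuum.Support.NE7CoarseCurvatureLetter
import Summits.QuantumFields.BalabanUV.T4Continuum.Support.NE3EnergyHessTwoTerm
import Summits.QuantumFields.BalabanUV.T4Continuum.Support.NE3HessBounds
import Summits.QuantumFields.BalabanUV.T4Continuum.Support.NE3FramePotBoundComplex
import Summits.QuantumFields.BalabanUV.T4Continuum.Support.NE3SmoothLiftCurl
import Literature.MathematicalPhysics.QuantumFieldTheory.Balaban1983to89.T4TermwiseUN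
import HarnessLib

/-!
# NE7FlatSkewSlice — row NE7 (node U5), the (A)-bill's END at the trivial flat datum: THE SKEW PART OF A TANGENT FIELD KEEPS EVERY
# LETTER F44 ASKS OF THE NORMAL PART, so F44's pointwise bootstrap holds with the slice solver letter `G♭` asked on the SKEW SLICE ONLY
# (the repair R1 + R1b of the NE7 pricing desk's finding E-62-1, packaged as one theorem)

Lineage `b2b-balaban-t4-ne7-p2` (CRUX PROVER NE7 #2, co-owner of row NE7), generation 83.  Over F44 `NE7FlatLiftBookkeeping` (OWNER lineage
`b2b-balaban-t4-ne7-p1`), the NE3 Hessian kit (`NE3HessForm ∕ NE3HessBounds ∕ NE3EnergyHessTwoTerm ∕ NE3EnergyHessBilin`), B7's contour average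
`Tside ∕ Tcoarse` (`B7Prop1Explicit`, `SmoothRefineNeutral`, `NE3TangentCovariantTower.dirIter_flat`) and lit-balaban's matrix skew part
`T4TermwiseUN.skewPartM` (`½(X − Xᴴ)`).

WHY.  The END of the (A)-bill's trivial-datum programme (OWNER's F54 v2 `NE7ApeTrivialFlatEnd`, HOME, unproposed) feeds F44
`smallField_vary_of_flatLetters'` with the slice `S :=` ALL complex periodic tangent fields at `1` and the slice solver letter
`hG : ∀ X ∈ S, … (∀ Y skew periodic tangent, |hess 1 X Y| ≤ g·‖Y‖₁) → ‖curl 1 X‖ ≤ K_G·g`.  The NE7 pricing desk's kernel finding E-62-1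
(`run/shared/lean/pub/pub-balaban/b2b-balaban-t4-ne7-refuter/PRICING-NE7.md` v60 §434, kit `g62/HGProbe.lean` d3922ff9668e152e) is that this `hG` is
UNSATISFIABLE: at the flat background the real Hessian pairing against skew test directions is blind to the Hermitian part of `X` (witness `i·X_w`), so
the END is vacuous as typed.  The desk's repair menu (§435): R1 — ask `hG` on SKEW `X` only; then the slice clause `A − A_N ∈ S` needs a skew normal
part, supplied by R1b — replace `A_N` by its skew part `½(A_N − A_Nᴴ)`, every letter surviving.  THIS FILE carries out R1 + R1b once and for all:
* §1 matrix complements to `skewPartM` (`_eq_smul`, `_sub`, `_mem`, `_eq_self`, `sub_skewPartM_mem_selfAdjoint`, `_real_smulC`, **`norm_skewPartM_le`**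
  `‖½(C − Cᴴ)‖ ≤ ‖C‖` in the operator norm);
* §2 the field-level skew part `skewPart X` (skew; periodic if `X` is; `= X` on skew `X`);
* §3 the curl letter: **`curlAt_flat_skewPart`** `curl 1 (sk X) = sk (curl 1 X)`, hence `‖curl 1 (sk X)(p)‖ ≤ ‖curl 1 X (p)‖`;
* §4 the NORTH letter: **`hess_flat_selfAdjoint_skew`** (`hess 1 X Y W = 0` for Hermitian-valued `X`, skew `Y` — the desk's blindness lemma, `HGProbe` §5)
  and **`hess_flat_skewPart`** `hess 1 (sk X) Y W = hess 1 X Y W` for skew `Y`;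
* §5 naturality of B7's `stepA ∕ asum ∕ Tside ∕ Tcoarse` under any ADDITIVE map commuting with REAL scalars (the tree's `NE3FramePotBoundComplex.*_map`
  is the `ℂ`-linear case; `X ↦ Xᴴ` is only real-linear), whence **`dirIter_flat_skewPart`** `dirIter L j 1 (sk X) = sk (dirIter L j 1 X)` — EXACTNESS;
* §6 **`smallField_vary_flat_of_flatLetters_skew`**: F44's `smallField_vary_of_flatLetters'` at `Ft = 1` VERBATIM except (i) no slice parameter — the
  solver letter is asked for SKEW periodic tangent `X` (binder `IsSkewDir X →`), (ii) the class radius is fixed at `x = 0` (`levelSmall_zero`); `A_N` is NOT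
  asked skew (the proof passes `skewPart A_N` to F44 with `S := {X | IsSkewDir X}`).  The desk's witness `i·X_w` is not skew, so T-62-1 is met; per lattice
  the skew-slice letter is satisfiable (finite-dimensional; the desk's §434 (d)), its `k`-UNIFORM constant is the (A)-bill's XL(c) content, untouched here.
HONEST FRAMING (page 1): [folklore] bookkeeping (matrix adjoints, finite sums); nothing of Bałaban's asserted; the G♭ ∕ (1.115) second-entry letter and
REP♭'s top normalisation stay HYPOTHESES of the END exactly as before; NOT (APE), NOT ONE-STEP, NOT NE7; letters unchanged (PRICING-NE7 v62: XL(c)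
critical; VACUOUS-AS-TYPED 1 is a word about F54 v2, cleared only by a v3); spine 0∕9; finite T⁴ rung (B)+1 — NOT infinite volume, NOT mass gap, NOT
Clay.  Continuum YM on T⁴ ⇐ BetaPertH ∧ nine spine estimates (0/9 proved); BetaPertH ⇐ (D1) ∧ (D4) ∧ CAP+tail; G-an2-4 gates asym, D1 and NE2/3/4.
-/

set_option autoImplicit false

open scoped BigOperators Matrix Matrix.Norms.L2Operator
open NormedSpace Finset Set

namespace Summit.QuantumFields.BalabanUV.T4Continuum.NE7FlatSkewSlice

open Literature.MathematicalPhysics.QuantumFieldTheory.Balaban1983to89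
open B7Prop1Explicit B7Prop2Explicit UnitaryModel
open T4AveragingDeficitWall (IsUnitaryCfg IsSkewDir SmallField vary curlAt dirL1 Ad flat_mem_classes hol_flat)
open T4AveragingDeficitWallBoundary (periodBox)
open AveragingDeficitPeriodicCounting (IsPeriodicDir)
open AveragingDeficitMultiLevelPrep (LevelSmall)
open MinimalActionLevels (perWin)
open BlockAveragePushDirSplit (flat)
open SmoothRefineNeutral (Tcoarse)
open NE3HessForm (hess hessPlaq hessPlaqAt dcurlAt dAction)
open NE3TangentCovariantTower (dirIter dirIter_flat)
open NE3EnergyHessBilin (hess_add_left)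
open NE3SmoothLiftCurl (curlAt_flat_eq)
open NE7FlatLiftBookkeeping (smallField_vary_of_flatLetters')
open NE7CoarseCurvatureLetter (levelSmall_zero)
open T4TermwiseUN (skewPartM skewPartM_conjTranspose skewPartM_of_skew skewPartM_add)

noncomputable section

variable {d : ℕ} {n : Type*} [Fintype n] [DecidableEq n]

/-! ## §1 Matrix complements to the skew part `skewPartM C = ½(C − Cᴴ)` -/

section MatrixLevel

omit [Fintype n] [DecidableEq n] in
/-- `½(C − Cᴴ)` with the scalar read in `ℂ`. [folklore] -/
theorem skewPartM_eq_smul (C : Matrix n n ℂ) : skewPartM C = (2⁻¹ : ℂ) • (C - Cᴴ) := by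
  rw [skewPartM, ← algebraMap_smul ℂ (2⁻¹ : ℝ) (C - Cᴴ), map_inv₀, map_ofNat]

omit [Fintype n] [DecidableEq n] in
/-- `skewPartM 0 = 0`. [folklore] -/
theorem skewPartM_zero' : skewPartM (0 : Matrix n n ℂ) = 0 := by
  rw [skewPartM_eq_smul, Matrix.conjTranspose_zero, sub_zero, smul_zero]

omit [Fintype n] [DecidableEq n] in
/-- The skew part is subtractive. [folklore] -/
theorem skewPartM_sub (C D : Matrix n n ℂ) : skewPartM (C - D) = skewPartM C - skewPartM D := by
  rw [skewPartM_eq_smul, skewPartM_eq_smul, skewPartM_eq_smul, Matrix.conjTranspose_sub, ← smul_sub]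
  congr 1
  abel

omit [Fintype n] [DecidableEq n] in
/-- The skew part is skew-adjoint. [folklore] -/
theorem skewPartM_mem (C : Matrix n n ℂ) : skewPartM C ∈ skewAdjoint (Matrix n n ℂ) := by
  rw [skewAdjoint.mem_iff, Matrix.star_eq_conjTranspose, skewPartM_conjTranspose]

omit [Fintype n] [DecidableEq n] in
/-- On skew-adjoint matrices the skew part is the identity. [folklore] -/
theorem skewPartM_eq_self {C : Matrix n n ℂ} (hC : C ∈ skewAdjoint (Matrix n n ℂ)) : skewPartM C = C :=
  skewPartM_of_skew (by rwa [skewAdjoint.mem_iff, Matrix.star_eq_conjTranspose] at hC)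

omit [Fintype n] [DecidableEq n] in
/-- The complement `C − ½(C − Cᴴ) = ½(C + Cᴴ)` is self-adjoint. [folklore] -/
theorem sub_skewPartM_mem_selfAdjoint (C : Matrix n n ℂ) : C - skewPartM C ∈ selfAdjoint (Matrix n n ℂ) := by
  rw [selfAdjoint.mem_iff, Matrix.star_eq_conjTranspose, Matrix.conjTranspose_sub, skewPartM_conjTranspose, skewPartM_eq_smul]
  module

omit [Fintype n] [DecidableEq n] in
/-- The skew part commutes with REAL scalars (read in `ℂ`). [folklore] -/
theorem skewPartM_real_smulC (r : ℝ) (C : Matrix n n ℂ) : skewPartM ((r : ℂ) • C) = (r : ℂ) • skewPartM C := by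
  rw [skewPartM_eq_smul, skewPartM_eq_smul, Matrix.conjTranspose_smul, Complex.star_def, Complex.conj_ofReal, ← smul_sub, smul_comm]

/-- **`‖½(C − Cᴴ)‖ ≤ ‖C‖`** in the operator norm (`‖Cᴴ‖ = ‖C‖`). [folklore] -/
theorem norm_skewPartM_le (C : Matrix n n ℂ) : ‖skewPartM C‖ ≤ ‖C‖ := by
  rw [skewPartM_eq_smul, norm_smul, norm_inv, Complex.norm_ofNat]
  calc (2 : ℝ)⁻¹ * ‖C - Cᴴ‖ ≤ 2⁻¹ * (‖C‖ + ‖Cᴴ‖) := by gcongr; exact norm_sub_le _ _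
    _ = ‖C‖ := by rw [Matrix.l2_opNorm_conjTranspose]; ring

end MatrixLevel

/-! ## §2 The skew part of a direction field -/

/-- THE SKEW PART of a direction field, bondwise: `skewPart X y μ = ½(X y μ − (X y μ)ᴴ)`. [folklore] -/
def skewPart (X : Site d → Fin d → Matrix n n ℂ) : Site d → Fin d → Matrix n n ℂ := fun y μ => skewPartM (X y μ)

omit [Fintype n] [DecidableEq n] in
/-- unfolding. [folklore] -/
theorem skewPart_apply (X : Site d → Fin d → Matrix n n ℂ) (y : Site d) (μ : Fin d) : skewPart X y μ = skewPartM (X y μ) := rfl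

omit [Fintype n] [DecidableEq n] in
/-- The skew part is a skew (`𝔲(N)`-valued) direction field. [folklore] -/
theorem isSkewDir_skewPart (X : Site d → Fin d → Matrix n n ℂ) : IsSkewDir (skewPart X) := fun y μ => skewPartM_mem (X y μ)

omit [Fintype n] [DecidableEq n] in
/-- On skew direction fields the skew part is the identity. [folklore] -/
theorem skewPart_eq_self {X : Site d → Fin d → Matrix n n ℂ} (hX : IsSkewDir X) : skewPart X = X :=
  funext fun y => funext fun μ => skewPartM_eq_self (hX y μ)

omit [Fintype n] [DecidableEq n] in
/-- The skew part of a `P`-periodic field is `P`-periodic. [folklore] -/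
theorem isPeriodicDir_skewPart {X : Site d → Fin d → Matrix n n ℂ} {P : ℤ} (hXP : IsPeriodicDir X P) : IsPeriodicDir (skewPart X) P :=
  fun x κ μ => by rw [skewPart_apply, skewPart_apply, hXP x κ μ]

/-- Bondwise `‖skewPart X‖ ≤ ‖X‖`. [folklore] -/
theorem norm_skewPart_le (X : Site d → Fin d → Matrix n n ℂ) (y : Site d) (μ : Fin d) : ‖skewPart X y μ‖ ≤ ‖X y μ‖ :=
  norm_skewPartM_le (X y μ)

omit [Fintype n] [DecidableEq n] in
/-- The complement `X − skewPart X` is Hermitian-valued. [folklore] -/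
theorem sub_skewPart_mem_selfAdjoint (X : Site d → Fin d → Matrix n n ℂ) (y : Site d) (μ : Fin d) :
    X y μ - skewPart X y μ ∈ selfAdjoint (Matrix n n ℂ) :=
  sub_skewPartM_mem_selfAdjoint (X y μ)

omit [Fintype n] [DecidableEq n] in
/-- `X = skewPart X + (X − skewPart X)`. [folklore] -/
theorem skewPart_add_sub (X : Site d → Fin d → Matrix n n ℂ) : (skewPart X + fun y μ => X y μ - skewPart X y μ) = X := by
  funext y μ
  simp only [Pi.add_apply, add_sub_cancel]

/-! ## §3 The curl letter: at the flat background the dressed curl commutes with the skew part -/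

/-- **`curl 1 (skewPart X) = skewPart (curl 1 X)`** plaquette by plaquette (the flat curl is a `±`-combination of four bond values). [folklore] -/
theorem curlAt_flat_skewPart (X : Site d → Fin d → Matrix n n ℂ) (z : Site d) (μ ν : Fin d) :
    curlAt (flat (d := d) (n := n)) (skewPart X) z μ ν = skewPartM (curlAt (flat (d := d) (n := n)) X z μ ν) := by
  rw [curlAt_flat_eq, curlAt_flat_eq, skewPartM_sub, skewPartM_sub, skewPartM_sub]
  rfl

/-- **THE CURL LETTER SURVIVES**: `‖curl 1 (skewPart X)(p′)‖ ≤ ‖curl 1 X (p′)‖`. [folklore] -/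
theorem norm_curlAt_flat_skewPart_le (X : Site d → Fin d → Matrix n n ℂ) (z : Site d) (μ ν : Fin d) :
    ‖curlAt (flat (d := d) (n := n)) (skewPart X) z μ ν‖ ≤ ‖curlAt (flat (d := d) (n := n)) X z μ ν‖ := by
  rw [curlAt_flat_skewPart]
  exact norm_skewPartM_le _

/-- At the flat background the dressed curl of a Hermitian-valued field is Hermitian.
-- adapted from HOME/b2b-balaban-t4-ne7-refuter/g62/HGProbe.lean §5 (NE7 pricing desk, E-62-1). [folklore] -/
theorem curlAt_flat_mem_selfAdjoint {X : Site d → Fin d → Matrix n n ℂ} (hX : ∀ x μ, X x μ ∈ selfAdjoint (Matrix n n ℂ)) (z : Site d)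
    (μ ν : Fin d) :
    curlAt (flat (d := d) (n := n)) X z μ ν ∈ selfAdjoint (Matrix n n ℂ) := by
  rw [curlAt_flat_eq]
  exact (selfAdjoint (Matrix n n ℂ)).sub_mem ((selfAdjoint (Matrix n n ℂ)).sub_mem (hX _ _) (hX _ _))
    ((selfAdjoint (Matrix n n ℂ)).sub_mem (hX _ _) (hX _ _))

/-! ## §4 The NORTH letter: the flat Hessian pairing against skew test directions is blind to Hermitian parts -/

omit [DecidableEq n] in
/-- `Re tr(K·H) = 0` for `K` skew-adjoint and `H` self-adjoint.
-- adapted from HOME/b2b-balaban-t4-ne7-refuter/g62/HGProbe.lean §5 (NE7 pricing desk, E-62-1). [folklore] -/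
theorem nReTr_skew_mul_selfAdjoint {K H : Matrix n n ℂ} (hK : K ∈ skewAdjoint (Matrix n n ℂ)) (hH : H ∈ selfAdjoint (Matrix n n ℂ)) :
    nReTr (K * H) = 0 := by
  rw [skewAdjoint.mem_iff, Matrix.star_eq_conjTranspose] at hK
  rw [selfAdjoint.mem_iff, Matrix.star_eq_conjTranspose] at hH
  have h1 : star (K * H).trace = -(K * H).trace := by
    rw [← Matrix.trace_conjTranspose, Matrix.conjTranspose_mul, hH, hK, Matrix.mul_neg, Matrix.trace_neg, Matrix.trace_mul_comm]
  have h2 := congrArg Complex.re h1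
  rw [Complex.star_def, Complex.conj_re, Complex.neg_re] at h2
  have h3 : (K * H).trace.re = 0 := by linarith
  simp [nReTr, h3]

/-- One plaquette: `hessPlaqAt 1 X Y = 0` for Hermitian-valued `X` and skew `Y` (the `dcurlAt` term has zero real trace, the product term pairs the skew
`curl 1 Y` with the Hermitian `curl 1 X`). [folklore] -/
theorem hessPlaqAt_flat_selfAdjoint_skew {X Y : Site d → Fin d → Matrix n n ℂ} (hX : ∀ x μ, X x μ ∈ selfAdjoint (Matrix n n ℂ)) (hY : IsSkewDir Y)
    (z : Site d) (μ ν : Fin d) : hessPlaqAt (flat (d := d) (n := n)) X Y z μ ν = 0 := by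
  have hKH : nReTr (curlAt (flat (d := d) (n := n)) Y z μ ν * curlAt (flat (d := d) (n := n)) X z μ ν) = 0 :=
    nReTr_skew_mul_selfAdjoint (NE3HessBounds.curlAt_mem_skewAdjoint NE3FramePotBound.isUnitaryCfg_flat hY z μ ν)
      (curlAt_flat_mem_selfAdjoint hX z μ ν)
  rw [hessPlaqAt, hol_flat, Units.val_one, mul_one, T4TiltOscillation.nReTr_add, NE3EnergyHessTwoTerm.nReTr_dcurlAt, zero_add,
    hKH, neg_zero]

/-- **BLINDNESS**: `hess 1 X Y W = 0` for every Hermitian-valued `X`, every skew `Y`, every window `W`.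
-- adapted from HOME/b2b-balaban-t4-ne7-refuter/g62/HGProbe.lean §5 `hess_flat_selfAdjoint_skew` (NE7 pricing desk, E-62-1). [folklore] -/
theorem hess_flat_selfAdjoint_skew {X Y : Site d → Fin d → Matrix n n ℂ} (hX : ∀ x μ, X x μ ∈ selfAdjoint (Matrix n n ℂ)) (hY : IsSkewDir Y)
    (W : Finset (T4AveragingDeficitWall.Plaq d)) : hess (flat (d := d) (n := n)) X Y W = 0 :=
  Finset.sum_eq_zero fun p _ => hessPlaqAt_flat_selfAdjoint_skew hX hY p.1 p.2.1.1 p.2.1.2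

/-- **THE NORTH ∕ HESSIAN LETTER SURVIVES**: `hess 1 (skewPart X) Y W = hess 1 X Y W` for every skew `Y` (`X − skewPart X` is Hermitian-valued).
[folklore] -/
theorem hess_flat_skewPart (X : Site d → Fin d → Matrix n n ℂ) {Y : Site d → Fin d → Matrix n n ℂ} (hY : IsSkewDir Y)
    (W : Finset (T4AveragingDeficitWall.Plaq d)) :
    hess (flat (d := d) (n := n)) (skewPart X) Y W = hess (flat (d := d) (n := n)) X Y W := by
  have h := hess_add_left (flat (d := d) (n := n)) W (skewPart X) (fun y μ => X y μ - skewPart X y μ) Y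
  rw [skewPart_add_sub, hess_flat_selfAdjoint_skew (sub_skewPart_mem_selfAdjoint X) hY W, add_zero] at h
  exact h.symm

/-! ## §5 Naturality of B7's contour sum and contour average under additive real-homogeneous maps; EXACTNESS of the skew part -/

section Naturality

variable {𝔸 𝔹 : Type*} [NormedRing 𝔸] [NormedAlgebra ℂ 𝔸] [NormedRing 𝔹] [NormedAlgebra ℂ 𝔹]

omit [NormedAlgebra ℂ 𝔸] [NormedAlgebra ℂ 𝔹] in
/-- Naturality of the letter contribution `stepA` under an additive map. [folklore] -/
theorem stepA_mapA (ψ : 𝔸 →+ 𝔹) (A : Site d → Fin d → 𝔸) (x : Site d) (l : Letter d) :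
    stepA (fun y κ => ψ (A y κ)) x l = ψ (stepA A x l) := by
  unfold stepA
  split_ifs
  · rfl
  · rw [map_neg]

omit [NormedAlgebra ℂ 𝔸] [NormedAlgebra ℂ 𝔹] in
/-- Naturality of the abelian path functional `asum` under an additive map. [folklore] -/
theorem asum_mapA (ψ : 𝔸 →+ 𝔹) (A : Site d → Fin d → 𝔸) : ∀ (x : Site d) (w : List (Letter d)),
    asum (fun y κ => ψ (A y κ)) x w = ψ (asum A x w)
  | x, [] => by rw [asum_nil, asum_nil, map_zero]
  | x, l :: w => by rw [asum_cons, asum_cons, stepA_mapA, asum_mapA ψ A (x + l.vec) w, map_add]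

/-- Naturality of the contour average `Tside` under an additive map commuting with REAL scalars (the weights of B7 (42) are real). [folklore] -/
theorem Tside_mapA (ψ : 𝔸 →+ 𝔹) (hψ : ∀ (r : ℝ) (a : 𝔸), ψ ((r : ℂ) • a) = (r : ℂ) • ψ a) (L : ℕ) (A : Site d → Fin d → 𝔸)
    (q : Site d) (κ : Fin d) : Tside L (fun y μ => ψ (A y μ)) q κ = ψ (Tside L A q κ) := by
  unfold Tside
  rw [map_sum]
  refine Finset.sum_congr rfl fun r _ => ?_
  rw [asum_mapA, ← Complex.coe_smul, ← Complex.coe_smul, hψ]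

/-- Naturality of `Tcoarse` under an additive real-homogeneous map. [folklore] -/
theorem Tcoarse_mapA (ψ : 𝔸 →+ 𝔹) (hψ : ∀ (r : ℝ) (a : 𝔸), ψ ((r : ℂ) • a) = (r : ℂ) • ψ a) (L : ℕ) (A : Site d → Fin d → 𝔸)
    (z : Site d) (κ : Fin d) : Tcoarse L (fun y μ => ψ (A y μ)) z κ = ψ (Tcoarse L A z κ) := by
  unfold Tcoarse
  exact Tside_mapA ψ hψ L A _ κ

/-- Naturality of the `m`-fold linearised average `(Tcoarse L)^[m]` under an additive real-homogeneous map. [folklore] -/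
theorem iterate_Tcoarse_mapA (ψ : 𝔸 →+ 𝔹) (hψ : ∀ (r : ℝ) (a : 𝔸), ψ ((r : ℂ) • a) = (r : ℂ) • ψ a) (L : ℕ) :
    ∀ (m : ℕ) (A : Site d → Fin d → 𝔸), (Tcoarse L)^[m] (fun y μ => ψ (A y μ)) = fun z κ => ψ ((Tcoarse L)^[m] A z κ)
  | 0, A => rfl
  | m + 1, A => by
      have h1 : Tcoarse L (fun y μ => ψ (A y μ)) = fun z κ => ψ (Tcoarse L A z κ) := by
        funext z κ; exact Tcoarse_mapA ψ hψ L A z κ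
      rw [Function.iterate_succ_apply, Function.iterate_succ_apply, h1, iterate_Tcoarse_mapA ψ hψ L m]

end Naturality

omit [Fintype n] [DecidableEq n] in
/-- The skew part as an additive self-map of `M_N(ℂ)`. [folklore] -/
def skewPartHom : Matrix n n ℂ →+ Matrix n n ℂ where
  toFun := skewPartM
  map_zero' := skewPartM_zero'
  map_add' := skewPartM_add

omit [Fintype n] [DecidableEq n] in
/-- unfolding. [folklore] -/
theorem skewPartHom_apply (C : Matrix n n ℂ) : skewPartHom C = skewPartM C := rfl

/-- **EXACTNESS SURVIVES**: at the flat background the `j`-fold linearised average commutes with the skew part,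
`dirIter L j 1 (skewPart X) = skewPart (dirIter L j 1 X)` (B7's contour averages have real weights). [folklore] -/
theorem dirIter_flat_skewPart {L : ℕ} (hL : 1 ≤ L) (j : ℕ) (X : Site d → Fin d → Matrix n n ℂ) :
    dirIter L j (flat (d := d) (n := n)) (skewPart X) = skewPart (dirIter L j (flat (d := d) (n := n)) X) := by
  rw [dirIter_flat hL, dirIter_flat hL]
  exact iterate_Tcoarse_mapA (skewPartHom (n := n)) (fun r a => skewPartM_real_smulC r a) L j X

/-- At the flat background the `j`-fold linearised average of a skew field is skew (no periodicity or smallness needed). [folklore] -/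
theorem isSkewDir_dirIter_flat {L : ℕ} (hL : 1 ≤ L) (j : ℕ) {X : Site d → Fin d → Matrix n n ℂ} (hX : IsSkewDir X) :
    IsSkewDir (dirIter L j (flat (d := d) (n := n)) X) := by
  rw [← skewPart_eq_self hX, dirIter_flat_skewPart hL]
  exact isSkewDir_skewPart _

/-! ## §6 F44's pointwise bootstrap at the flat datum with the slice solver letter on the SKEW slice (R1 + R1b of E-62-1) -/

/-- **F38∕F44's POINTWISE BOOTSTRAP AT `1` WITH `G♭` ASKED ON SKEW PERIODIC TANGENT FIELDS ONLY.**  Hypotheses, in F44's order (`Ft = 1`, class radius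
`x = 0`): the exponent `A` (skew, `P`-periodic, `‖A‖ ≤ α₀`); a normal part `A_N` — NOT asked skew — with its four letters PERIODIC, EXACT
(`dirIter L (k+1) 1 A_N = dirIter L (k+1) 1 A`), CURL (`‖curl 1 A_N‖ ≤ c_N` off the diagonal) and NORTH (`hess 1 A_N Y = 0` on skew periodic tangent `Y`);
the slice solver letter **on the skew slice**: for every SKEW `P`-periodic `X` with `dirIter L (k+1) 1 X = 0` and every `g ≥ 0`, if
`|hess 1 X Y (perWin)| ≤ g·‖Y‖_{ℓ¹(periodBox)}` for all skew periodic tangent `Y` then `‖curl 1 X‖ ≤ K_G·g` off the diagonal; the remainder letter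
`hEXP` (`ρ`), criticality `hcrit`, the tangent transport letter `hTT` (`τ`).  Conclusion: `SmallField (vary 1 A 1) (K_G(τ + ρ) + c_N + 28α₀²)`.
Proof: F44 `smallField_vary_of_flatLetters'` with the normal part `skewPart A_N` (§§2–5: its four letters are those of `A_N`) and the slice
`S := {X | IsSkewDir X}` (so `A − skewPart A_N ∈ S`).  The desk's E-62-1 witness (Hermitian `i·X_w`) is excluded by the skew binder (T-62-1). [folklore] -/
theorem smallField_vary_flat_of_flatLetters_skew [Nonempty n] {L : ℕ} (hL : 1 ≤ L) (k : ℕ) {P : ℕ}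
    {A : Site d → Fin d → Matrix n n ℂ} (hA : IsSkewDir A) (hAP : IsPeriodicDir A (P : ℤ)) {α₀ : ℝ} (hAα : ∀ y μ, ‖A y μ‖ ≤ α₀)
    {AN : Site d → Fin d → Matrix n n ℂ} (hNP : IsPeriodicDir AN (P : ℤ))
    (hNexact : dirIter L (k + 1) (flat (d := d) (n := n)) AN = dirIter L (k + 1) (flat (d := d) (n := n)) A)
    {cN : ℝ} (hN7 : ∀ z μ ν, μ ≠ ν → ‖curlAt (flat (d := d) (n := n)) AN z μ ν‖ ≤ cN)
    (hNorth : ∀ Y : Site d → Fin d → Matrix n n ℂ, IsSkewDir Y → IsPeriodicDir Y (P : ℤ) → dirIter L (k + 1) (flat (d := d) (n := n)) Y = 0 →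
      hess (flat (d := d) (n := n)) AN Y (perWin d P) = 0)
    {KG : ℝ}
    (hG : ∀ X : Site d → Fin d → Matrix n n ℂ, IsSkewDir X → IsPeriodicDir X (P : ℤ) → dirIter L (k + 1) (flat (d := d) (n := n)) X = 0 →
      ∀ g : ℝ, 0 ≤ g →
      (∀ Y : Site d → Fin d → Matrix n n ℂ, IsSkewDir Y → IsPeriodicDir Y (P : ℤ) → dirIter L (k + 1) (flat (d := d) (n := n)) Y = 0 →
        |hess (flat (d := d) (n := n)) X Y (perWin d P)| ≤ g * dirL1 Y (periodBox (d := d) P)) →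
      ∀ z μ ν, μ ≠ ν → ‖curlAt (flat (d := d) (n := n)) X z μ ν‖ ≤ KG * g)
    {ρ : ℝ} (hρ : 0 ≤ ρ)
    (hEXP : ∀ Y : Site d → Fin d → Matrix n n ℂ, IsSkewDir Y → IsPeriodicDir Y (P : ℤ) →
      |dAction (vary (flat (d := d) (n := n)) A 1) Y (perWin d P) - hess (flat (d := d) (n := n)) A Y (perWin d P)|
        ≤ ρ * dirL1 Y (periodBox (d := d) P))
    (hcrit : ∀ Y' : Site d → Fin d → Matrix n n ℂ, IsSkewDir Y' → IsPeriodicDir Y' (P : ℤ) →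
      dirIter L (k + 1) (vary (flat (d := d) (n := n)) A 1) Y' = 0 → dAction (vary (flat (d := d) (n := n)) A 1) Y' (perWin d P) = 0)
    {τ : ℝ} (hτ : 0 ≤ τ)
    (hTT : ∀ Y : Site d → Fin d → Matrix n n ℂ, IsSkewDir Y → IsPeriodicDir Y (P : ℤ) → dirIter L (k + 1) (flat (d := d) (n := n)) Y = 0 →
      ∃ Y' : Site d → Fin d → Matrix n n ℂ, IsSkewDir Y' ∧ IsPeriodicDir Y' (P : ℤ) ∧
        dirIter L (k + 1) (vary (flat (d := d) (n := n)) A 1) Y' = 0 ∧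
        |dAction (vary (flat (d := d) (n := n)) A 1) (fun y μ => Y' y μ - Y y μ) (perWin d P)| ≤ τ * dirL1 Y (periodBox (d := d) P)) :
    SmallField (vary (flat (d := d) (n := n)) A 1) (KG * (τ + ρ) + cN + 28 * α₀ ^ 2) := by
  have hflatU : IsUnitaryCfg (flat (d := d) (n := n)) := (flat_mem_classes (d := d) (n := n) le_rfl).1
  have hflat0 : SmallField (flat (d := d) (n := n)) 0 := (flat_mem_classes (d := d) (n := n) le_rfl).2
  refine smallField_vary_of_flatLetters' hL k hflatU hflat0 le_rfl (levelSmall_zero L k) hflat0 hA hAP hAα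
    (isPeriodicDir_skewPart hNP) ?_ (fun z μ ν hμν => (norm_curlAt_flat_skewPart_le AN z μ ν).trans (hN7 z μ ν hμν)) ?_
    {X | IsSkewDir X} ?_ (fun X hX => hG X hX) hρ hEXP hcrit hτ hTT
  · -- EXACT: `dirIter 1 (sk A_N) = sk (dirIter 1 A_N) = sk (dirIter 1 A) = dirIter 1 A` (`A` skew)
    rw [dirIter_flat_skewPart hL, hNexact, ← dirIter_flat_skewPart hL, skewPart_eq_self hA]
  · -- NORTH: blindness to the Hermitian part
    intro Y hY hYP hYT
    rw [hess_flat_skewPart AN hY]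
    exact hNorth Y hY hYP hYT
  · -- the slice clause: `A − sk A_N` is skew
    exact fun y μ => (skewAdjoint (Matrix n n ℂ)).sub_mem (hA y μ) (isSkewDir_skewPart AN y μ)

end

end Summit.QuantumFields.BalabanUV.T4Continuum.NE7FlatSkewSlice
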